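import Summits.Schanuel.Schanuel.Theorems.DiophantineDichotomyKhovanskiiApproxTypeEvSyncDiazSlot
import Summits.Schanuel.Schanuel.Theorems.DiophantineDichotomyKhovanskiiApproxTypeEvFinrankRange
import Summits.Schanuel.Schanuel.Theorems.DiophantineDichotomyKhovanskiiApproxTypeEvPairSumMeasure
import HarnessLib

/-!
# The ANCHORED synchronised floor, engine (`stub_anchoredSyncCore`) — crux `DiophantineDichotomy.KhovanskiiApproxTypeEv`
# (stmt-Schanuel-14972), line `Sketch`, sub-goal J₀ (skeleton v16; lead `prover-line-stmt-Schanuel-14972-c14-0`) — `--supports`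

Companion of sub-goal I (`…EvLWSynchronisedFloor.lean`, the floor `a ≥ 1/n` at every LW point).  Here ONE coordinate
of the target is an ANCHOR — any complex number, approximated by Diaz's theorem (`Bugeaud2004_thm_8_11_holds`) at a
FREE scale `M`; as in `Negative/ConjugateFloor.lean` its own Mahler measure `M(α₀)` normalises the height and the
`deg α₀ · log M` term absorbs every slack — while the other transcendental coordinates are `e^{βᵢ}` (`βᵢ ≠ 0`
algebraic), met by SYNCHRONISED Diaz slots (sub-goal H `stub_syncDiazSlot`, p172470) at the common scale
`M' = max(M(α₀), T)`, and algebraic coordinates are met exactly.  Engine over any finite index type (so `(π, e)`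
of `EPiSimultaneousTypeEv` is served too; equal synchronised VALUES share one approximant): no eventual bound
`exp(−C(dᵃ log H + dᵇ)) ≤ ‖γ − v‖` with `a < 1/(#sync values + 1)`; both regimes of `M(α₀)` vs `T` are fatal (`M(α₀) ≥ T`: `0.006 m log M(α₀)` beats
`κ m log M(α₀)`, `κ ≤ 0.003`; `M(α₀) < T`: bounded height while `0.006 deg α₀ log M → ∞`).  The instances
— sub-goal J `stub_anchoredSyncFloor` (`θ = (s, e^s)` with one anchor `s_{k₀}`, `e^{s_{k₀}}` algebraic, other
`s_k` algebraic non-zero: no eventual type with `a < 1/n`), the flagship `(1, iπ)` and `(1, e)` floors `1/2`,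
the anchored family, the `EPiSimultaneousTypeEv` window `[1/2, 1)` — are in `…EvFlagshipFloor.lean` (sub-goal K).
Everything is proved; no named facts.
-/

noncomputable section

set_option linter.dupNamespace false

namespace Summit.Schanuel.Schanuel.Cruxes.KhovanskiiApproxTypeEv.AnchoredReduction

open Summit.Schanuel.Schanuel.Cruxes.KhovanskiiApproxType.Negative
  (natHeight abs_coeff_le_natHeight natHeight_le exists_deg)
open Literature.NumberTheory.DiophantineApproximation (Bugeaud2004_thm_8_11_holds one_le_mahlerMeasure_map)
open Polynomial

set_option maxHeartbeats 3200000 in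
/-- **SUB-GOAL J₀ — THE ANCHORED SYNCHRONISED FLOOR, ENGINE** (registered `stub_anchoredSyncCore`).  Let `v : ι → ℂ` be a finite tuple, `i₀` an
"anchor" index (no hypothesis on `v i₀`), `Sy ∌ i₀` a set of "synchronised" indices with `v i = e^{βᵢ}`,
`βᵢ ≠ 0` algebraic, and every other coordinate algebraic.  Then NO eventual simultaneous approximation
bound `exp(−C(dᵃ log H + dᵇ)) ≤ ‖γ − v‖` (over challengers `γ` of common field degree `≤ d` whose
coordinates are roots of non-zero integer polynomials of degree `≤ d` and height `≤ H`, `H ≥ H₀(d)`) can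
hold with `a < 1/(#v(Sy) + 1)` (distinct synchronised VALUES count once: equal targets share one approximant).  Challengers: Diaz's approximant `α₀` of the anchor at a free scale `M`
(`Bugeaud2004_thm_8_11_holds`; its own Mahler measure `M(α₀)` normalises the height and its
`deg α₀ · log M` term absorbs every slack), the synchronised Diaz approximants (sub-goal H) of the
`e^{βᵢ}` at the common scale `M' = max(M(α₀), T)`, and the algebraic coordinates themselves; common
field degree `≤ F·m^{#v(Sy)+1}`. [cite: Bugeaud2004, Thm 8.11] -/
theorem stub_anchoredSyncCore : ∀ {ι : Type} [Fintype ι] [DecidableEq ι] (v : ι → ℂ) (i₀ : ι)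
    (Sy : Finset ι), i₀ ∉ Sy → (∀ i ∈ Sy, ∃ β : ℂ, IsAlgebraic ℚ β ∧ β ≠ 0 ∧ v i = Complex.exp β) →
    (∀ i, i ∉ Sy → i ≠ i₀ → IsAlgebraic ℚ (v i)) → ∀ (a b C : ℝ), 0 < C →
    a < 1 / (((Sy.image v).card : ℝ) + 1) →
    (∀ d : ℕ, ∃ H₀ : ℕ, ∀ (H : ℕ) (γ : ι → ℂ), H₀ ≤ H →
      Module.finrank ℚ ↥(IntermediateField.adjoin ℚ (Set.range γ)) ≤ d →
      (∀ i, ∃ P : Polynomial ℤ, P ≠ 0 ∧ P.natDegree ≤ d ∧ (∀ k, |P.coeff k| ≤ (H : ℤ)) ∧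
        Polynomial.aeval (γ i) P = 0) →
      Real.exp (-(C * ((d : ℝ) ^ a * Real.log H + (d : ℝ) ^ b))) ≤ ‖γ - v‖) → False := by
  intro ι _ _ v i₀ Sy hi₀ hsync halg a b C hC ha hall
  set N : ℕ := (Sy.image v).card with hNdef
  have hmemW : ∀ i, i ∈ Sy → v i ∈ Sy.image v := fun i hi => Finset.mem_image_of_mem v hi
  have hN0 : (0 : ℝ) ≤ N := Nat.cast_nonneg _
  have hN1 : (1 : ℝ) ≤ (N : ℝ) + 1 := by linarith
  have hNpos : (0 : ℝ) < (N : ℝ) + 1 := by linarith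
  set a' : ℝ := max a 0 with ha'
  set b' : ℝ := max b 0 with hb'
  have ha'lt : a' < 1 / ((N : ℝ) + 1) := max_lt ha (by positivity)
  set e : ℝ := ((N : ℝ) + 1) * a' with hedef
  have he1 : e < 1 := by
    have h := (lt_div_iff₀ hNpos).mp ha'lt
    rw [hedef]; linarith [mul_comm ((N : ℝ) + 1) a']
  -- the synchronised slots (sub-goal H), indexed by `↥Sy`; `q₁ ≤ min(qᵢ, 3/1000)`
  have hW : ∀ w : ↥(Sy.image v), ∃ β : ℂ, IsAlgebraic ℚ β ∧ β ≠ 0 ∧ (w : ℂ) = Complex.exp β := fun w => by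
    obtain ⟨i, hi, hiw⟩ := Finset.mem_image.1 w.2
    obtain ⟨β, h1, h2, h3⟩ := hsync i hi
    exact ⟨β, h1, h2, by rw [← hiw, h3]⟩
  choose β hβalg hβ0 hvβ using hW
  choose q hq0 hq using fun w => stub_syncDiazSlot (β w) (hβalg w) (hβ0 w)
  have hqinv : ∀ i, 0 ≤ 1 / q i := fun i => (one_div_pos.mpr (hq0 i)).le
  set q₁ : ℝ := 1 / (1 + 1000 / 3 + ∑ i, 1 / q i) with hq₁def
  have hS0 : 0 ≤ ∑ i, 1 / q i := Finset.sum_nonneg fun i _ => hqinv i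
  have hq₁pos : 0 < q₁ := by rw [hq₁def]; positivity
  have hq₁le : ∀ i, q₁ ≤ q i := fun i => by
    have h1 : 1 / q i ≤ 1 + 1000 / 3 + ∑ j, 1 / q j := by
      have := Finset.single_le_sum (fun j _ => hqinv j) (Finset.mem_univ i)
      linarith
    have h2 := one_div_le_one_div_of_le (one_div_pos.mpr (hq0 i)) h1
    rwa [one_div_one_div] at h2
  have hq₁3 : q₁ ≤ 3 / 1000 := by
    have h2 := one_div_le_one_div_of_le (by norm_num) (by linarith : (1000 / 3 : ℝ) ≤ 1 + 1000 / 3 + ∑ j, 1 / q j)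
    exact h2.trans (le_of_eq (by norm_num))
  set κ : ℝ := q₁ / 2 with hκdef
  have hκpos : 0 < κ := by positivity
  have hκ3 : κ ≤ 3 / 1000 := by rw [hκdef]; linarith
  -- fixed clauses of the algebraic coordinates (dummies elsewhere)
  have hT : ∀ i, ∃ (T : Polynomial ℤ) (B : ℕ), 1 ≤ T.natDegree ∧
      ((i ∉ Sy ∧ i ≠ i₀) → (T ≠ 0 ∧ (∀ l, |T.coeff l| ≤ (B : ℤ)) ∧ Polynomial.aeval (v i) T = 0)) := by
    intro i
    by_cases h : i ∉ Sy ∧ i ≠ i₀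
    · obtain ⟨T, B, hT0, hTB, hTroot⟩ := exists_intPoly_bound_of_isAlgebraic (halg i h.1 h.2)
      exact ⟨T, B, one_le_budget_of_clause ⟨T, hT0, le_rfl, hTB, hTroot⟩, fun _ => ⟨hT0, hTB, hTroot⟩⟩
    · exact ⟨X, 0, by simp, fun h' => absurd h' h⟩
  choose T B hT1 hTcl using hT
  set Fall : ℕ := ∏ i, (T i).natDegree with hFdef
  have hFpos : 0 < Fall := by rw [hFdef]; exact Finset.prod_pos fun i _ => hT1 i
  have hF1 : 1 ≤ Fall := hFpos
  have hTF : ∀ i, (T i).natDegree ≤ Fall := fun i =>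
    Nat.le_of_dvd hFpos (Finset.dvd_prod_of_mem (fun j => (T j).natDegree) (Finset.mem_univ i))
  set Bs : ℕ := ∑ i, B i with hBsdef
  have hBBs : ∀ i, B i ≤ Bs := fun i =>
    Finset.single_le_sum (fun j _ => Nat.zero_le (B j)) (Finset.mem_univ i)
  -- the Diaz degree `m`: `C (F m^{N+1})^{a'} ≤ κ m`
  set C' : ℝ := C * (Fall : ℝ) ^ a' * (3 / 1000 / κ) with hC'def
  have hC'pos : 0 < C' := by positivity
  obtain ⟨m, hm50, hm⟩ := exists_deg e C' he1 hC'pos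
  have hm1nat : 1 ≤ m := le_trans (by norm_num) hm50
  have hm1 : (1 : ℝ) ≤ m := by exact_mod_cast hm1nat
  have hmpos : (0 : ℝ) < m := by linarith only [hm1]
  have hkey_m : C * (Fall : ℝ) ^ a' * (m : ℝ) ^ e ≤ κ * m := by
    have hk : (0 : ℝ) < 3 / 1000 / κ := by positivity
    have h1 : C * (Fall : ℝ) ^ a' * (m : ℝ) ^ e * (3 / 1000 / κ) ≤ 3 / 1000 * m := by
      calc C * (Fall : ℝ) ^ a' * (m : ℝ) ^ e * (3 / 1000 / κ) = C' * (m : ℝ) ^ e := by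
            rw [hC'def]; ring
        _ ≤ 3 / 1000 * m := hm
    have h3 : 3 / 1000 * (m : ℝ) / (3 / 1000 / κ) = κ * m := by field_simp
    linarith [(le_div_iff₀ hk).mpr h1, h3.le, h3.ge]
  -- the budget `d = F m^{N+1}`
  set d : ℕ := Fall * m ^ (N + 1) with hddef
  have hdcast : (d : ℝ) = (Fall : ℝ) * (m : ℝ) ^ (N + 1) := by rw [hddef]; push_cast; ring
  have hmn : m ≤ m ^ (N + 1) := Nat.le_self_pow (Nat.succ_ne_zero N) m
  have hmd : m ≤ d := by rw [hddef]; exact le_trans hmn (Nat.le_mul_of_pos_left _ hF1)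
  have hFd : Fall ≤ d := by rw [hddef]; exact Nat.le_mul_of_pos_right _ (pow_pos hm1nat _)
  have hd1nat : 1 ≤ d := hm1nat.trans hmd
  have hd1 : (1 : ℝ) ≤ d := by exact_mod_cast hd1nat
  have hda' : C * (d : ℝ) ^ a' ≤ κ * m := by
    have h1 : (d : ℝ) ^ a' = (Fall : ℝ) ^ a' * (m : ℝ) ^ e := by
      rw [hdcast, Real.mul_rpow (by positivity) (by positivity)]
      congr 1
      rw [← Real.rpow_natCast, ← Real.rpow_mul hmpos.le]
      congr 1
      rw [hedef]; push_cast; ring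
    rw [h1, ← mul_assoc]
    exact hkey_m
  obtain ⟨H₀, hH₀⟩ := hall d
  set H₁ : ℕ := max H₀ (max 2 Bs) with hH₁def
  have hH₁2nat : 2 ≤ H₁ := (le_max_left 2 Bs).trans (le_max_right _ _)
  have hBsH₁ : Bs ≤ H₁ := (le_max_right 2 Bs).trans (le_max_right _ _)
  have hH₀H₁ : H₀ ≤ H₁ := le_max_left _ _
  have hH₁1 : (1 : ℝ) ≤ H₁ := by exact_mod_cast le_trans (by norm_num) hH₁2nat
  have hH₁pos : (0 : ℝ) < H₁ := by linarith only [hH₁1]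
  have hlogH₁ : 0 ≤ Real.log H₁ := Real.log_nonneg hH₁1
  -- the height slack `K1`, the synchronised thresholds, the scale floor `T`
  set K1 : ℝ := Real.log H₁ + Real.log ((N : ℝ) + 1) + m * Real.log 2 with hK1def
  choose M₀ hM₀ using fun w => hq w m hm50
  set L₁ : ℝ := (κ * m * K1 + C * (d : ℝ) ^ b') / (κ * m) with hL₁def
  set L₂ : ℝ := (κ * m * K1 + C * (d : ℝ) ^ b') / (3 / 1000 * m) with hL₂def
  set Tsc : ℝ := max (max (∑ i, max (M₀ i) 0) 1) (Real.exp (max L₁ L₂ + 1)) with hTdef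
  have hM₀T : ∀ i, M₀ i ≤ Tsc := fun i => by
    have h2 : max (M₀ i) 0 ≤ ∑ j, max (M₀ j) 0 :=
      Finset.single_le_sum (fun j _ => le_max_right (M₀ j) 0) (Finset.mem_univ i)
    exact (le_max_left _ _).trans (h2.trans ((le_max_left _ _).trans (le_max_left _ _)))
  have hTsc1 : (1 : ℝ) ≤ Tsc := (le_max_right _ _).trans (le_max_left _ _)
  have hTpos : 0 < Tsc := by linarith only [hTsc1]
  have hlogT : max L₁ L₂ + 1 ≤ Real.log Tsc := (Real.le_log_iff_exp_le hTpos).2 (le_max_right _ _)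
  have hlogT0 : 0 ≤ Real.log Tsc := Real.log_nonneg hTsc1
  set ξ₀ : ℂ := v i₀ with hξ₀
  set L₃ : ℝ := (κ * m * K1 + κ * m * Real.log Tsc + C * (d : ℝ) ^ b') / (6 / 1000) with hL₃def
  set M : ℝ := max (max ((m : ℝ) + 1) ((4 + ‖ξ₀‖) ^ 100)) (Real.exp (L₃ + 1)) with hMdef
  have hMm : (m : ℝ) + 1 ≤ M := (le_max_left _ _).trans (le_max_left _ _)
  have hMξ : (4 + ‖ξ₀‖) ^ 100 ≤ M := (le_max_right _ _).trans (le_max_left _ _)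
  have hM1 : (1 : ℝ) ≤ M := by linarith only [hMm, hm1]
  have hMpos : 0 < M := by linarith only [hM1]
  have hlogM0 : 0 ≤ Real.log M := Real.log_nonneg hM1
  have hlogM : L₃ + 1 ≤ Real.log M := (Real.le_log_iff_exp_le hMpos).2 (le_max_right _ _)
  obtain ⟨α₀, P₀, hP₀irr, hP₀α, hP₀deg, hP₀M, hdist₀⟩ := Bugeaud2004_thm_8_11_holds ξ₀ m M hm50 hMm hMξ
  have hP₀0 : P₀ ≠ 0 := hP₀irr.ne_zero
  have hdP₀ : 1 ≤ P₀.natDegree := by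
    rw [Nat.one_le_iff_ne_zero]
    intro h0
    have hc : P₀ = Polynomial.C (P₀.coeff 0) := eq_C_of_natDegree_eq_zero h0
    have h := hP₀α
    rw [hc, aeval_C, algebraMap_int_eq, eq_intCast, Int.cast_eq_zero] at h
    exact hP₀0 (by rw [hc, h, map_zero])
  set MP₀ : ℝ := (P₀.map (Int.castRingHom ℂ)).mahlerMeasure with hMP₀
  have hMP₀1 : 1 ≤ MP₀ := one_le_mahlerMeasure_map P₀ hP₀0
  have hlogMP₀ : 0 ≤ Real.log MP₀ := Real.log_nonneg hMP₀1
  set M' : ℝ := max MP₀ Tsc with hM'def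
  have hTM' : Tsc ≤ M' := le_max_right _ _
  have hMP₀M' : MP₀ ≤ M' := le_max_left _ _
  have hM'1 : (1 : ℝ) ≤ M' := hTsc1.trans hTM'
  have hM'pos : 0 < M' := by linarith only [hM'1]
  have hlogM'0 : 0 ≤ Real.log M' := Real.log_nonneg hM'1
  have hlogTM' : Real.log Tsc ≤ Real.log M' := Real.log_le_log hTpos hTM'
  choose α P hPirr hPα hdP hPdeg hPM hdist using fun w => hM₀ w M' ((hM₀T w).trans hTM')
  have hP0 : ∀ i, P i ≠ 0 := fun i => (hPirr i).ne_zero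
  set γ : ι → ℂ := fun i => if h : i ∈ Sy then α ⟨v i, hmemW i h⟩ else if i = i₀ then α₀ else v i with hγ
  have hγsy : ∀ (i : ι) (h : i ∈ Sy), γ i = α ⟨v i, hmemW i h⟩ := fun i h => by simp [hγ, h]
  have hγ₀ : γ i₀ = α₀ := by simp [hγ, hi₀]
  have hγalg : ∀ i, i ∉ Sy → i ≠ i₀ → γ i = v i := fun i h1 h2 => by simp [hγ, h1, h2]
  set Hn : ℕ := natHeight P₀ + ∑ i, natHeight (P i) with hHndef
  set H : ℕ := max H₁ Hn with hHdef
  have hHP₀ : natHeight P₀ ≤ H := (Nat.le_add_right _ _).trans (le_max_right _ _)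
  have hHnH : ∀ i, natHeight (P i) ≤ H := fun i =>
    ((Finset.single_le_sum (fun j _ => Nat.zero_le (natHeight (P j))) (Finset.mem_univ i)).trans
      (Nat.le_add_left _ _)).trans (le_max_right _ _)
  have hH0le : H₀ ≤ H := hH₀H₁.trans (le_max_left _ _)
  have hH2 : 2 ≤ H := hH₁2nat.trans (le_max_left _ _)
  have hH1r : (1 : ℝ) ≤ H := by exact_mod_cast le_trans (by norm_num) hH2
  have hHpos : (0 : ℝ) < H := by linarith only [hH1r]
  have hBH : ∀ i, (B i : ℤ) ≤ (H : ℤ) := fun i => by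
    exact_mod_cast (hBBs i).trans (hBsH₁.trans (le_max_left _ _))
  have hcl : ∀ i, ∃ Q : Polynomial ℤ, Q ≠ 0 ∧ Q.natDegree ≤ d ∧ (∀ k, |Q.coeff k| ≤ (H : ℤ)) ∧
      Polynomial.aeval (γ i) Q = 0 := by
    intro i
    by_cases hi : i ∈ Sy
    · refine ⟨P ⟨v i, hmemW i hi⟩, hP0 _, (hPdeg _).trans hmd,
        fun k => (abs_coeff_le_natHeight _ k).trans (by exact_mod_cast hHnH ⟨v i, hmemW i hi⟩), ?_⟩
      rw [hγsy i hi]; exact hPα _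
    by_cases hi0 : i = i₀
    · subst hi0
      refine ⟨P₀, hP₀0, hP₀deg.trans hmd,
        fun k => (abs_coeff_le_natHeight _ k).trans (by exact_mod_cast hHP₀), ?_⟩
      rw [hγ₀]; exact hP₀α
    · obtain ⟨hT0, hTB, hTroot⟩ := hTcl i ⟨hi, hi0⟩
      refine ⟨T i, hT0, (hTF i).trans hFd, fun k => (hTB k).trans (hBH i), ?_⟩
      rw [hγalg i hi hi0]; exact hTroot
  -- the common field `ℚ(γ) ⊆ ℚ(α_w (w ∈ v(Sy)), α₀, vᵢ (i algebraic))` has degree `≤ m^N · m · F = d`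
  set z : ↥(Sy.image v) ⊕ ι → ℂ := Sum.elim (fun w => α w) (fun i => if i ∈ Sy then 0 else γ i) with hz
  set budz : ↥(Sy.image v) ⊕ ι → ℕ :=
    Sum.elim (fun _ => m) (fun i => if i ∈ Sy then 1 else if i = i₀ then m else (T i).natDegree) with hbudz
  have hclz : ∀ x, ∃ Q : Polynomial ℤ, Q ≠ 0 ∧ Q.natDegree ≤ budz x ∧ Polynomial.aeval (z x) Q = 0 := by
    rintro (w | i)
    · exact ⟨P w, hP0 w, hPdeg w, hPα w⟩
    · by_cases hi : i ∈ Sy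
      · exact ⟨X, X_ne_zero, by simp [hbudz, hi], by simp [hz, hi]⟩
      by_cases hi0 : i = i₀
      · subst hi0
        exact ⟨P₀, hP₀0, by simpa [hbudz, hi] using hP₀deg, by simpa [hz, hi, hγ₀] using hP₀α⟩
      · obtain ⟨hT0, -, hTroot⟩ := hTcl i ⟨hi, hi0⟩
        exact ⟨T i, hT0, by simp [hbudz, hi, hi0], by simpa [hz, hi, hγalg i hi hi0] using hTroot⟩
  have hrange : Set.range γ ⊆ Set.range z := by
    rintro _ ⟨i, rfl⟩
    by_cases hi : i ∈ Sy
    · exact ⟨Sum.inl ⟨v i, hmemW i hi⟩, by simp [hz, hγsy i hi]⟩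
    · exact ⟨Sum.inr i, by simp [hz, hi]⟩
  have hzint : ∀ x ∈ Set.range z, IsIntegral ℚ x := by
    rintro _ ⟨x, rfl⟩
    obtain ⟨Q, hQ0, -, hQroot⟩ := hclz x
    refine isAlgebraic_iff_isIntegral.mp ⟨Q.map (algebraMap ℤ ℚ), ?_, ?_⟩
    · exact (Polynomial.map_ne_zero_iff (algebraMap ℤ ℚ).injective_int).mpr hQ0
    · rw [Polynomial.aeval_map_algebraMap]; exact hQroot
  haveI : FiniteDimensional ℚ ↥(IntermediateField.adjoin ℚ (Set.range z)) :=
    IntermediateField.finiteDimensional_adjoin hzint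
  have hbud_le : ∀ i ∈ (Finset.univ : Finset ι),
      (if i ∈ Sy then 1 else if i = i₀ then m else (T i).natDegree) ≤
        (if i = i₀ then m else (T i).natDegree) := by
    intro i _
    by_cases hi : i ∈ Sy
    · have hne : i ≠ i₀ := fun h => hi₀ (h ▸ hi)
      simpa [hi, hne] using hT1 i
    · simp [hi]
  have hprodι : ∏ i, (if i = i₀ then m else (T i).natDegree) ≤ m * Fall := by
    rw [← Finset.mul_prod_erase Finset.univ _ (Finset.mem_univ i₀), if_pos rfl]
    have hE : ∏ x ∈ Finset.univ.erase i₀, (if x = i₀ then m else (T x).natDegree) =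
        ∏ x ∈ Finset.univ.erase i₀, (T x).natDegree :=
      Finset.prod_congr rfl fun x hx => by rw [if_neg (Finset.ne_of_mem_erase hx)]
    have hF : Fall = (T i₀).natDegree * ∏ x ∈ Finset.univ.erase i₀, (T x).natDegree := by
      rw [hFdef]
      exact (Finset.mul_prod_erase Finset.univ (fun x => (T x).natDegree) (Finset.mem_univ i₀)).symm
    rw [hE]
    refine Nat.mul_le_mul_left m ?_
    rw [hF]
    exact Nat.le_mul_of_pos_left _ (hT1 i₀)
  have hfr : Module.finrank ℚ ↥(IntermediateField.adjoin ℚ (Set.range γ)) ≤ d := by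
    calc Module.finrank ℚ ↥(IntermediateField.adjoin ℚ (Set.range γ))
        ≤ Module.finrank ℚ ↥(IntermediateField.adjoin ℚ (Set.range z)) :=
          IntermediateField.finrank_le_of_le_right (IntermediateField.adjoin.mono ℚ _ _ hrange)
      _ ≤ ∏ x, budz x := stub_finrankAdjoinRangeLe z budz hclz
      _ = m ^ N * ∏ i, (if i ∈ Sy then 1 else if i = i₀ then m else (T i).natDegree) := by
          rw [Fintype.prod_sum_type]
          simp only [hbudz, Sum.elim_inl, Sum.elim_inr, Finset.prod_const, Finset.card_univ,
            Fintype.card_coe]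
          rw [← hNdef]
      _ ≤ m ^ N * (m * Fall) :=
          Nat.mul_le_mul_left _ ((Finset.prod_le_prod (fun i _ => Nat.zero_le _) hbud_le).trans hprodι)
      _ = d := by rw [hddef]; ring
  have key := hH₀ H γ hH0le hfr hcl
  -- the distance: anchor within `A`, synchronised slots within `S`, algebraic coordinates exact
  set A : ℝ := Real.exp (-(6 / 1000 * ((m : ℝ) * Real.log MP₀ + (P₀.natDegree : ℝ) * Real.log M)))
    with hAdef
  set S : ℝ := Real.exp (-(q₁ * m * Real.log M')) with hSdef
  have hmlogM' : 0 ≤ (m : ℝ) * Real.log M' := by positivity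
  have hdist' : ‖γ - v‖ ≤ max A S := by
    refine (pi_norm_le_iff_of_nonneg ((Real.exp_nonneg _).trans (le_max_left A S))).mpr fun i => ?_
    rw [Pi.sub_apply]
    by_cases hi : i ∈ Sy
    · rw [hγsy i hi]
      set w : ↥(Sy.image v) := ⟨v i, hmemW i hi⟩ with hw
      have hvi : v i = Complex.exp (β w) := hvβ w
      have hS' : Real.exp (-(q w * m * Real.log M')) ≤ S := by
        rw [hSdef, Real.exp_le_exp]
        have h1 : q₁ * (m * Real.log M') ≤ q w * (m * Real.log M') :=
          mul_le_mul_of_nonneg_right (hq₁le _) hmlogM'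
        linarith only [h1, mul_assoc q₁ (m : ℝ) (Real.log M'), mul_assoc (q w) (m : ℝ) (Real.log M')]
      calc ‖α w - v i‖ = ‖α w - Complex.exp (β w)‖ := by rw [← hvi]
        _ = ‖Complex.exp (β w) - α w‖ := norm_sub_rev _ _
        _ ≤ max A S := ((hdist w).trans hS').trans (le_max_right A S)
    by_cases hi0 : i = i₀
    · subst hi0
      rw [hγ₀, norm_sub_rev]
      exact hdist₀.trans (le_max_left A S)
    · rw [hγalg i hi hi0, sub_self, norm_zero]
      exact (Real.exp_nonneg _).trans (le_max_left A S)
  -- height bookkeeping: `log H ≤ K1 + log M'`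
  have hlogH : Real.log H ≤ K1 + Real.log M' := by
    have hbound : ∀ Q : Polynomial ℤ, Q.natDegree ≤ m → (Q.map (Int.castRingHom ℂ)).mahlerMeasure ≤ M' →
        (natHeight Q : ℝ) ≤ 2 ^ m * M' := fun Q hQd hQM => by
      calc (natHeight Q : ℝ) ≤ 2 ^ Q.natDegree * (Q.map (Int.castRingHom ℂ)).mahlerMeasure := natHeight_le _
        _ ≤ 2 ^ m * (Q.map (Int.castRingHom ℂ)).mahlerMeasure := by
            gcongr
            · exact Polynomial.mahlerMeasure_nonneg _
            · norm_num
        _ ≤ 2 ^ m * M' := mul_le_mul_of_nonneg_left hQM (by positivity)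
    have hHn : (Hn : ℝ) ≤ ((N : ℝ) + 1) * (2 ^ m * M') := by
      rw [hHndef]
      push_cast
      have h0 : (natHeight P₀ : ℝ) ≤ 2 ^ m * M' := hbound P₀ hP₀deg hMP₀M'
      have h1 : ∑ i, (natHeight (P i) : ℝ) ≤ N * (2 ^ m * M') := by
        calc ∑ i, (natHeight (P i) : ℝ) ≤ ∑ _i : ↥(Sy.image v), (2 : ℝ) ^ m * M' :=
              Finset.sum_le_sum fun i _ => hbound (P i) (hPdeg i) (hPM i)
          _ = N * (2 ^ m * M') := by
              rw [Finset.sum_const, Finset.card_univ, Fintype.card_coe, nsmul_eq_mul]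
      linarith only [h0, h1]
    have h2mM : (1 : ℝ) ≤ 2 ^ m * M' := one_le_mul_of_one_le_of_one_le (one_le_pow₀ (by norm_num)) hM'1
    have hHle : (H : ℝ) ≤ (H₁ : ℝ) * (((N : ℝ) + 1) * (2 ^ m * M')) := by
      have hcast : (H : ℝ) = max (H₁ : ℝ) (Hn : ℝ) := by rw [hHdef]; push_cast; rfl
      rw [hcast]
      refine max_le ?_ ?_
      · exact le_mul_of_one_le_right hH₁pos.le (one_le_mul_of_one_le_of_one_le hN1 h2mM)
      · exact hHn.trans (le_mul_of_one_le_left (by positivity) hH₁1)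
    calc Real.log H ≤ Real.log ((H₁ : ℝ) * (((N : ℝ) + 1) * (2 ^ m * M'))) := Real.log_le_log hHpos hHle
      _ = K1 + Real.log M' := by
        rw [Real.log_mul hH₁pos.ne' (by positivity), Real.log_mul hNpos.ne' (by positivity),
          Real.log_mul (by positivity) hM'pos.ne', Real.log_pow, hK1def]
        ring
  -- the bound to beat: `E ≤ κ m (K1 + log M') + C d^{b'}`
  set E : ℝ := C * ((d : ℝ) ^ a * Real.log H + (d : ℝ) ^ b) with hEdef
  have hna : (d : ℝ) ^ a ≤ (d : ℝ) ^ a' := Real.rpow_le_rpow_of_exponent_le hd1 (le_max_left _ _)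
  have hnb : (d : ℝ) ^ b ≤ (d : ℝ) ^ b' := Real.rpow_le_rpow_of_exponent_le hd1 (le_max_left _ _)
  have hlogH0 : 0 ≤ Real.log H := Real.log_nonneg hH1r
  have hda'0 : 0 ≤ (d : ℝ) ^ a' := by positivity
  have hκm : 0 < κ * m := by positivity
  have hE : E ≤ κ * m * K1 + κ * m * Real.log M' + C * (d : ℝ) ^ b' := by
    have step : C * (d : ℝ) ^ a' * Real.log H ≤ κ * m * Real.log H :=
      mul_le_mul_of_nonneg_right hda' hlogH0
    calc E ≤ C * ((d : ℝ) ^ a' * Real.log H + (d : ℝ) ^ b') := by rw [hEdef]; gcongr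
      _ = C * (d : ℝ) ^ a' * Real.log H + C * (d : ℝ) ^ b' := by ring
      _ ≤ κ * m * Real.log H + C * (d : ℝ) ^ b' := by linarith only [step]
      _ ≤ κ * m * (K1 + Real.log M') + C * (d : ℝ) ^ b' := by
          have := mul_le_mul_of_nonneg_left hlogH hκm.le
          linarith only [this]
      _ = κ * m * K1 + κ * m * Real.log M' + C * (d : ℝ) ^ b' := by ring
  -- (S): the synchronised slots beat the bound, because `log M' ≥ log Tsc > L₁`
  have hS : S < Real.exp (-E) := by
    rw [hSdef, Real.exp_lt_exp]
    have hL₁ : L₁ + 1 ≤ Real.log M' := by linarith only [le_max_left L₁ L₂, hlogT, hlogTM']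
    have h := mul_le_mul_of_nonneg_left hL₁ hκm.le
    rw [mul_add, hL₁def, mul_div_cancel₀ _ hκm.ne', mul_one] at h
    have hq : q₁ * m * Real.log M' = 2 * (κ * m * Real.log M') := by rw [hκdef]; ring
    linarith only [hE, h, hq, hκm]
  -- (A): the anchor beats the bound, in both regimes of `M(α₀)` versus `Tsc`
  have hD₀ : Real.log M ≤ (P₀.natDegree : ℝ) * Real.log M :=
    le_mul_of_one_le_left hlogM0 (by exact_mod_cast hdP₀)
  have hD₀0 : 0 ≤ (P₀.natDegree : ℝ) * Real.log M := hlogM0.trans hD₀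
  have hmlogMP₀ : 0 ≤ (m : ℝ) * Real.log MP₀ := mul_nonneg hmpos.le hlogMP₀
  have hA : A < Real.exp (-E) := by
    rw [hAdef, Real.exp_lt_exp]
    rcases le_or_gt Tsc MP₀ with hcase | hcase
    · -- large Mahler measure: `M' = M(α₀)`, `log M(α₀) ≥ log Tsc > L₂`
      have hM'eq : M' = MP₀ := max_eq_left hcase
      have hL₂ : L₂ + 1 ≤ Real.log MP₀ := by
        linarith only [le_max_right L₁ L₂, hlogT, Real.log_le_log hTpos hcase]
      have h3m : (0 : ℝ) < 3 / 1000 * m := by positivity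
      have h := mul_le_mul_of_nonneg_left hL₂ h3m.le
      rw [mul_add, hL₂def, mul_div_cancel₀ _ h3m.ne', mul_one] at h
      have hκlog : κ * (m * Real.log MP₀) ≤ 3 / 1000 * (m * Real.log MP₀) :=
        mul_le_mul_of_nonneg_right hκ3 hmlogMP₀
      rw [hM'eq] at hE
      linarith only [hE, h, hκlog, hD₀0, h3m, hmlogMP₀]
    · -- small Mahler measure: `M' = Tsc`, and the free scale `M` pays (`log M > L₃`)
      have hM'eq : M' = Tsc := max_eq_right hcase.le
      rw [hM'eq] at hE
      have h6 : (0 : ℝ) < 6 / 1000 := by norm_num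
      have h := mul_le_mul_of_nonneg_left hlogM h6.le
      rw [mul_add, hL₃def, mul_div_cancel₀ _ h6.ne', mul_one] at h
      linarith only [hE, h, hD₀, hmlogMP₀]
  have hmax : max A S < Real.exp (-E) := max_lt hA hS
  linarith only [key.trans hdist', hmax]

end Summit.Schanuel.Schanuel.Cruxes.KhovanskiiApproxTypeEv.AnchoredReduction

end
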